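import Literature.Barriers.ValiantsHypothesis.AlgebraicNaturalProofsKRSTVNP

/-!
# Route BarrierLever — item `KRST2022` (stmt-ValiantsHypothesis-18971): the printed theorem, closed

The D-0059 ledger item `KRST2022` (Kumar–Ramya–Saptharishi–Tengse 2022, Main Theorem: "if the
permanent is exponentially hard then VNP has no efficiently computable equations", over `ℂ`) is
exactly the tree theorem
`Literature.Barriers.ValiantsHypothesis.succinctHittingSetsFromVNP_of_permanentExpHard`
(file `AlgebraicNaturalProofsKRSTVNP.lean`, no named-fact hypothesis) with the hardness hypothesis
`PermanentExpHardWith ℂ c m₀` and the class `SmallDefinable ℂ n b` spelled out by their bodies.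
This file states the item's signature verbatim and discharges it by that theorem.

WHAT THIS IS NOT: not a statement about `VP`-succinct hitting sets (crux `SuccinctHittingSetsForVP`,
FSV Question 6, stays open); the hypothesis (exponential hardness of the permanent) is not asserted.
-/

-- layout Summits/ValiantsHypothesis/ValiantsHypothesis forces the duplicated namespace component
set_option linter.dupNamespace false

namespace Summit.ValiantsHypothesis.ValiantsHypothesis.Theorems.BarrierLever

open MvPolynomial Literature.Computability.AlgebraicComplexity Literature.Barriers.ValiantsHypothesis

/-- **KRST 2022 Main Theorem** (item `KRST2022`, stmt-ValiantsHypothesis-18971, signature verbatim):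
if `per_{j^c}` needs circuits of size `≥ 2^j` for all `j ≥ m₀`, then there is one exponent `b` such
that for every `a`, eventually in `n`, the degree-`≤ n` Valiant Boolean sums of width/size/degree
`≤ n^b` (`VNP_{n,b}`) form a succinct hitting set for `Distinguishers ℂ n a`.
Proof: `succinctHittingSetsFromVNP_of_permanentExpHard` (the two inlined bodies are
`PermanentExpHardWith ℂ c m₀` and `SmallDefinable ℂ n b` by `rfl`). -/
theorem krst2022_holds :
    (∃ c m₀ : ℕ, ∀ j : ℕ, m₀ ≤ j → 2 ^ j ≤ complexity (perPoly (Fin (j ^ c)) ℂ)) →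
      ∃ b : ℕ, ∀ a : ℕ, ∃ n₀ : ℕ, ∀ n : ℕ, n₀ ≤ n →
        IsSuccinctHittingSet (degLEMonomials n)
          {f : MvPolynomial (Fin n) ℂ | f.totalDegree ≤ n ∧ ∃ u : ℕ, u ≤ n ^ b ∧
            ∃ g : MvPolynomial (Fin n ⊕ Fin u) ℂ, complexity g ≤ n ^ b ∧ g.totalDegree ≤ n ^ b ∧
              f = boolSum g}
          (Distinguishers ℂ n a) := by
  rintro ⟨c, m₀, hper⟩
  exact succinctHittingSetsFromVNP_of_permanentExpHard (F := ℂ) (c := c) (m₀ := m₀) hper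

end Summit.ValiantsHypothesis.ValiantsHypothesis.Theorems.BarrierLever
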